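import Summits.QuantumFields.YangMills.Theorems.LuscherReductionTwistedTraceScalingBOStiffAssembly
import Summits.QuantumFields.YangMills.Theorems.LuscherReductionTwistedTraceScalingBOStiffSlowTop
import HarnessLib

/-!
# (B-ST) stub (L-2): the slow operator bound `hkop` of `form_le_of_product_near` — `∫∫ a K_B b ≤ topValue·√∫a²·√∫b²` (any `L`, in particular the one-site lattice)
# (lane A of S-BASE, crux `TwistedTraceScaling` stmt-QuantumFields-20203, C4-CORE, the (B-ST) pen; HANDOFF-g21 STUB LEDGER (L-2))

PF-lite `qform_le_topValue_mul_l2_of_bdd` (✓ `…BOStiffSlowTop`: `⟨ψ, K_B ψ⟩ ≤ topValue·∫ψ²` for ALL bounded measurable `ψ`) is bilinearised by the Cauchy–Schwarz inequality of the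
positive semi-definite kernel form (`kform_sq_le`, ✓ `…BOStiffFibreBilinear`; data `transferKernel_kform_data`, ✓ `…BOStiffAssembly`):
★★★ `kernel_bilinear_le_topValue` — `∫∫ a(U) K_B(U,V) b(V) ≤ topValue su2Rep L B · (√∫a² · √∫b²)` for bounded measurable `a, b`, `B ≥ 0`;
★★ `hkop_oneSite` — the same at `L = 1` in EXACTLY the hypothesis shape `hkop` of `…BOStiffSlowAssembly.form_le_of_product_near` (`ν = configMeasure SU2 1`, `k = K_B^{(1)}`,
`κ₀ = topValue su2Rep 1 B`; the sign hypotheses on `a, b` are not needed and ignored).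
HONEST FRAMING: bookkeeping for a stub of a child of the CONDITIONAL route R2b1; (B-ST) OPEN; C4-CORE OPEN; not infinite volume, not a gap, not Clay.
-/

set_option autoImplicit false

noncomputable section

open MeasureTheory

namespace Summit.QuantumFields.YangMills.Theorems.FemtoTransferGap.TwoLattice.ConstTube

open Literature.MathematicalPhysics.QuantumFieldTheory Literature.MathematicalPhysics.QuantumLattice TwoLattice.Avg StiffDoor

/-- ★★★ **Bilinear PF-lite**: `∫∫ a(U) K_B(U,V) b(V) dU dV ≤ topValue·(√∫a² · √∫b²)` for bounded measurable `a, b` and `B ≥ 0`. [cite: SeilerLNP1982, §3] -/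
theorem kernel_bilinear_le_topValue {L : ℕ} [NeZero L] {B : ℝ} (hB : 0 ≤ B) {a b : GaugeConfig 3 L SU2 → ℝ} (ha : Measurable a) {Ca : ℝ} (hCa : ∀ U, |a U| ≤ Ca)
    (hb : Measurable b) {Cb : ℝ} (hCb : ∀ U, |b U| ≤ Cb) :
    ∫ U, ∫ V, a U * transferKernel su2Rep B U V * b V ∂configMeasure SU2 L ∂configMeasure SU2 L ≤
      topValue su2Rep L B * (Real.sqrt (∫ U, a U ^ 2 ∂configMeasure SU2 L) * Real.sqrt (∫ U, b U ^ 2 ∂configMeasure SU2 L)) := by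
  obtain ⟨hKm, ⟨CM, hKb⟩, hKs, hKp⟩ := transferKernel_kform_data (L := L) hB
  have hκ : 0 ≤ topValue su2Rep L B := topValue_nonneg su2Rep L B
  -- the two diagonal forms are bounded by `topValue · ∫ψ²`
  have hQ : ∀ {ψ : GaugeConfig 3 L SU2 → ℝ}, Measurable ψ → ∀ {C : ℝ}, (∀ U, |ψ U| ≤ C) →
      ∫ U, ∫ V, ψ U * transferKernel su2Rep B U V * ψ V ∂configMeasure SU2 L ∂configMeasure SU2 L ≤ topValue su2Rep L B * ∫ U, ψ U ^ 2 ∂configMeasure SU2 L := by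
    intro ψ hψ C hC
    have h := PhysL2.qform_le_topValue_mul_l2_of_bdd (L := L) B hψ hC
    have e : l2 ψ ψ = ∫ U, ψ U ^ 2 ∂configMeasure SU2 L := integral_congr_ae (ae_of_all _ fun U => by ring)
    rwa [qform_eq_integral_integral_bdd B hψ hC, e] at h
  have hA0 : 0 ≤ ∫ U, a U ^ 2 ∂configMeasure SU2 L := integral_nonneg fun U => sq_nonneg _
  have hB0 : 0 ≤ ∫ U, b U ^ 2 ∂configMeasure SU2 L := integral_nonneg fun U => sq_nonneg _
  have hQa := hQ ha hCa
  have hQb := hQ hb hCb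
  have hQa0 : 0 ≤ ∫ U, ∫ V, a U * transferKernel su2Rep B U V * a V ∂configMeasure SU2 L ∂configMeasure SU2 L := hKp a ha ⟨Ca, hCa⟩
  have hQb0 : 0 ≤ ∫ U, ∫ V, b U * transferKernel su2Rep B U V * b V ∂configMeasure SU2 L ∂configMeasure SU2 L := hKp b hb ⟨Cb, hCb⟩
  -- Cauchy–Schwarz for the PSD kernel form
  have hCS := kform_sq_le (μ := configMeasure SU2 L) hKm hKb hKs hKp ha hCa hb hCb
  set X := ∫ U, ∫ V, a U * transferKernel su2Rep B U V * b V ∂configMeasure SU2 L ∂configMeasure SU2 L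
  have h1 : X ≤ Real.sqrt (X ^ 2) := by rw [Real.sqrt_sq_eq_abs]; exact le_abs_self X
  have h2 : Real.sqrt (X ^ 2) ≤ Real.sqrt ((topValue su2Rep L B * ∫ U, a U ^ 2 ∂configMeasure SU2 L) * (topValue su2Rep L B * ∫ U, b U ^ 2 ∂configMeasure SU2 L)) :=
    Real.sqrt_le_sqrt (hCS.trans (mul_le_mul hQa hQb hQb0 ((hQa0.trans hQa))))
  have h3 : Real.sqrt ((topValue su2Rep L B * ∫ U, a U ^ 2 ∂configMeasure SU2 L) * (topValue su2Rep L B * ∫ U, b U ^ 2 ∂configMeasure SU2 L)) =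
      topValue su2Rep L B * (Real.sqrt (∫ U, a U ^ 2 ∂configMeasure SU2 L) * Real.sqrt (∫ U, b U ^ 2 ∂configMeasure SU2 L)) := by
    rw [Real.sqrt_mul (mul_nonneg hκ hA0), Real.sqrt_mul hκ, Real.sqrt_mul hκ]
    have e : Real.sqrt (topValue su2Rep L B) * Real.sqrt (topValue su2Rep L B) = topValue su2Rep L B := Real.mul_self_sqrt hκ
    calc Real.sqrt (topValue su2Rep L B) * Real.sqrt (∫ U, a U ^ 2 ∂configMeasure SU2 L) * (Real.sqrt (topValue su2Rep L B) * Real.sqrt (∫ U, b U ^ 2 ∂configMeasure SU2 L))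
        = (Real.sqrt (topValue su2Rep L B) * Real.sqrt (topValue su2Rep L B)) * (Real.sqrt (∫ U, a U ^ 2 ∂configMeasure SU2 L) * Real.sqrt (∫ U, b U ^ 2 ∂configMeasure SU2 L)) := by ring
      _ = _ := by rw [e]
  linarith [h1, h2, h3]

/-- ★★ **`hkop` for the one-site slow kernel**, in exactly the hypothesis shape of `…BOStiffSlowAssembly.form_le_of_product_near`
(`ν = configMeasure SU2 1`, `k = K_B` on the one-site lattice, `κ₀ = topValue su2Rep 1 B`). [cite: SeilerLNP1982, §3] -/
theorem hkop_oneSite {B : ℝ} (hB : 0 ≤ B) :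
    ∀ a b : GaugeConfig 3 1 SU2 → ℝ, Measurable a → Measurable b → (∃ C : ℝ, ∀ u, |a u| ≤ C) → (∃ C : ℝ, ∀ u, |b u| ≤ C) → (∀ u, 0 ≤ a u) → (∀ u, 0 ≤ b u) →
      ∫ u, ∫ u', a u * transferKernel su2Rep B u u' * b u' ∂configMeasure SU2 1 ∂configMeasure SU2 1 ≤
        topValue su2Rep 1 B * (Real.sqrt (∫ u, a u ^ 2 ∂configMeasure SU2 1) * Real.sqrt (∫ u, b u ^ 2 ∂configMeasure SU2 1)) :=
  fun _ _ ha hb ⟨_, hCa⟩ ⟨_, hCb⟩ _ _ => kernel_bilinear_le_topValue hB ha hCa hb hCb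

end Summit.QuantumFields.YangMills.Theorems.FemtoTransferGap.TwoLattice.ConstTube

end
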